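import Literature.NumberTheory.Automorphic.AdelicMatrixPoisson
import HarnessLib

/-!
# The theta series `Θ_Φ(A, B) = Σ_{ξ ∈ M_n(K)} Φ(A ξ B)` of a Schwartz–Bruhat function on `M_n(𝔸_K)`:
# regular and singular parts, and the Poisson (reflection) formula

Topic `NumberTheory/Automorphic`; namespace `Literature.NumberTheory.Automorphic`. The combinatorial
half of the theta-series identity behind the analytic continuation and functional equation of the
global zeta integrals of Godement–Jacquet (LNM 260 (1972), §12–13), on `AdelicMatrixPoisson`:

* `gjTheta n K Φ A B = Σ_{ξ ∈ M_n(K)} Φ(A ξ B)` (absolutely convergent, `summable_norm_gjThetaTerm`),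
  its **regular part** `gjThetaReg` (`ξ ∈ GL_n(K)`; as a sum over `GL (Fin n) K`,
  `gjThetaReg_eq_tsum_generalLinearGroup`, and over the arithmetic subgroup of `GL_n(𝔸_K)`,
  `gjThetaReg_eq_tsum_arithmeticSubgroup` — the form delivered by the kernel of `GLnZetaKernel`) and
  **singular part** `gjThetaSing` (`det ξ = 0`, `not_isUnit_iff_det_eq_zero`), with
  `gjTheta_eq_gjThetaReg_add_gjThetaSing`;
* `gjTheta_eq_smul_gjTheta_adelicMatrixFourier` — **the reflection formula**
  `Θ_Φ(A, B) = λ(D_M)⁻¹ |det A|_𝔸⁻ⁿ |det B|_𝔸⁻ⁿ Θ_{Φ̂}(B⁻¹, A⁻¹)` (Poisson summation for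
  `x ↦ Φ(A x B)` and the substitution formula for its Fourier transform), and its regular-part form
  `gjThetaReg_eq_reflection`;
* `gjThetaSing_fin_one` — for `n = 1` the singular part is the single term `Φ(0)` (the source of the
  poles of Tate's zeta function at `s = 0, 1`).

Everything is proved; definitions: `ratMatrix`, `gjTheta`, `gjThetaReg`, `gjThetaSing`,
`generalLinearGroupEquivIsUnit`, `glRationalEquivArithmeticSubgroup`.

## References

* R. Godement, H. Jacquet, *Zeta functions of simple algebras*, LNM 260 (1972), §12–13
  [GodementJacquet1972].
* J. Tate, in Cassels–Fröhlich (eds.), *Algebraic Number Theory* (1967), Ch. XV, §4.2, proof of the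
  Main Theorem 4.4.1 [CasselsFrohlichANT1967].
-/

noncomputable section

open MeasureTheory Measure Set Filter Topology IsDedekindDomain NumberField
open scoped ENNReal NNReal MatrixGroups

namespace Literature.NumberTheory.Automorphic

section Theta

variable (n : ℕ) (K : Type) [Field K] [NumberField K]

/-- A rational matrix as an adelic matrix (entrywise diagonal embedding). [folklore] -/
abbrev ratMatrix (ξ : Matrix (Fin n) (Fin n) K) : Matrix (Fin n) (Fin n) (AdeleRing (𝓞 K) K) :=
  ξ.map (algebraMap K (AdeleRing (𝓞 K) K))

/-- **The theta series** `Θ_Φ(A, B) = Σ_{ξ ∈ M_n(K)} Φ(A ξ B)` of `Φ ∈ 𝒮(M_n(𝔸_K))` twisted by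
`A, B ∈ GL_n(𝔸_K)` (Godement–Jacquet (1972), §12, the sums `Σ_ξ Φ(h⁻¹ ξ g)`; absolutely convergent,
`summable_norm_gjThetaTerm`). [cite: GodementJacquet1972, §12] -/
def gjTheta (Φ : Matrix (Fin n) (Fin n) (AdeleRing (𝓞 K) K) → ℂ) (A B : GL (Fin n) (AdeleRing (𝓞 K) K)) : ℂ :=
  ∑' ξ : Matrix (Fin n) (Fin n) K,
    Φ ((A : Matrix (Fin n) (Fin n) (AdeleRing (𝓞 K) K)) * ratMatrix n K ξ * (B : Matrix (Fin n) (Fin n) (AdeleRing (𝓞 K) K)))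

/-- **The regular part** `Θ_Φ^reg(A, B) = Σ_{ξ ∈ GL_n(K)} Φ(A ξ B)` (invertible rational matrices).
[cite: GodementJacquet1972, §12] -/
def gjThetaReg (Φ : Matrix (Fin n) (Fin n) (AdeleRing (𝓞 K) K) → ℂ) (A B : GL (Fin n) (AdeleRing (𝓞 K) K)) : ℂ :=
  ∑' ξ : {ξ : Matrix (Fin n) (Fin n) K // IsUnit ξ},
    Φ ((A : Matrix (Fin n) (Fin n) (AdeleRing (𝓞 K) K)) * ratMatrix n K ξ * (B : Matrix (Fin n) (Fin n) (AdeleRing (𝓞 K) K)))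

/-- **The singular part** `Θ_Φ^sing(A, B) = Σ_{ξ ∈ M_n(K), det ξ = 0} Φ(A ξ B)` (the terms which the
cuspidality of the automorphic forms kills for `n ≥ 2`, and which produce the poles of Tate's zeta
function for `n = 1`, where the singular set is `{0}`). [cite: GodementJacquet1972, §12] -/
def gjThetaSing (Φ : Matrix (Fin n) (Fin n) (AdeleRing (𝓞 K) K) → ℂ) (A B : GL (Fin n) (AdeleRing (𝓞 K) K)) : ℂ :=
  ∑' ξ : {ξ : Matrix (Fin n) (Fin n) K // ¬ IsUnit ξ},
    Φ ((A : Matrix (Fin n) (Fin n) (AdeleRing (𝓞 K) K)) * ratMatrix n K ξ * (B : Matrix (Fin n) (Fin n) (AdeleRing (𝓞 K) K)))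

variable {n K}

/-- **Absolute convergence of the theta series**: `Σ_{ξ ∈ M_n(K)} |Φ(A ξ B)| < ∞`
(`x ↦ Φ(A x B)` is again Schwartz–Bruhat, `comp_mul_mul_mem_schwartzBruhatAdelicMatrix`, and
`summable_norm_of_mem_schwartzBruhatAdelicMatrix`). [folklore] -/
theorem summable_norm_gjThetaTerm {Φ : Matrix (Fin n) (Fin n) (AdeleRing (𝓞 K) K) → ℂ}
    (hΦ : Φ ∈ schwartzBruhatAdelicMatrix n K) (A B : GL (Fin n) (AdeleRing (𝓞 K) K)) :
    Summable fun ξ : Matrix (Fin n) (Fin n) K =>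
      ‖Φ ((A : Matrix (Fin n) (Fin n) (AdeleRing (𝓞 K) K)) * ratMatrix n K ξ *
        (B : Matrix (Fin n) (Fin n) (AdeleRing (𝓞 K) K)))‖ :=
  (summable_norm_of_mem_schwartzBruhatAdelicMatrix (comp_mul_mul_mem_schwartzBruhatAdelicMatrix hΦ A B) :)

/-- **`Θ = Θ^reg + Θ^sing`.** [folklore] -/
theorem gjTheta_eq_gjThetaReg_add_gjThetaSing {Φ : Matrix (Fin n) (Fin n) (AdeleRing (𝓞 K) K) → ℂ}
    (hΦ : Φ ∈ schwartzBruhatAdelicMatrix n K) (A B : GL (Fin n) (AdeleRing (𝓞 K) K)) :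
    gjTheta n K Φ A B = gjThetaReg n K Φ A B + gjThetaSing n K Φ A B :=
  ((summable_norm_gjThetaTerm hΦ A B).of_norm.tsum_subtype_add_tsum_subtype_compl
    {ξ : Matrix (Fin n) (Fin n) K | IsUnit ξ}).symm

/-- Invertible rational matrices as a subtype of all matrices: `GL_n(K) ≃ {ξ // IsUnit ξ}`.
[folklore] -/
def generalLinearGroupEquivIsUnit (R : Type*) [CommRing R] (m : Type*) [Fintype m] [DecidableEq m] :
    GL m R ≃ {ξ : Matrix m m R // IsUnit ξ} where
  toFun g := ⟨(g : Matrix m m R), Units.isUnit g⟩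
  invFun ξ := ξ.2.unit
  left_inv _ := Units.ext rfl
  right_inv ξ := Subtype.ext (IsUnit.unit_spec ξ.2)

/-- **The regular part as a sum over `GL_n(K)`.** [folklore] -/
theorem gjThetaReg_eq_tsum_generalLinearGroup (Φ : Matrix (Fin n) (Fin n) (AdeleRing (𝓞 K) K) → ℂ)
    (A B : GL (Fin n) (AdeleRing (𝓞 K) K)) :
    gjThetaReg n K Φ A B = ∑' g : GL (Fin n) K,
      Φ ((A : Matrix (Fin n) (Fin n) (AdeleRing (𝓞 K) K)) * ratMatrix n K (g : Matrix (Fin n) (Fin n) K) *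
        (B : Matrix (Fin n) (Fin n) (AdeleRing (𝓞 K) K))) := by
  rw [gjThetaReg, ← (generalLinearGroupEquivIsUnit K (Fin n)).tsum_eq]
  rfl

omit [NumberField K] in
/-- The singular set is `{det = 0}` (`Matrix.isUnit_iff_isUnit_det` over the field `K`).
[folklore] -/
theorem not_isUnit_iff_det_eq_zero (ξ : Matrix (Fin n) (Fin n) K) : ¬ IsUnit ξ ↔ ξ.det = 0 := by
  rw [Matrix.isUnit_iff_isUnit_det, isUnit_iff_ne_zero (a := ξ.det), not_not]

variable [MeasurableSpace (AdeleRing (𝓞 K) K)] [BorelSpace (AdeleRing (𝓞 K) K)]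
  [MeasurableSpace (Matrix (Fin n) (Fin n) (AdeleRing (𝓞 K) K))]
  [BorelSpace (Matrix (Fin n) (Fin n) (AdeleRing (𝓞 K) K))]
  (lam : Measure (Matrix (Fin n) (Fin n) (AdeleRing (𝓞 K) K))) [lam.IsAddHaarMeasure] [lam.Regular]

/-- **The reflection formula for the theta series** (Poisson summation on `M_n(K) ⊂ M_n(𝔸_K)` for
`x ↦ Φ(A x B)` and the substitution formula for its Fourier transform; Godement–Jacquet (1972), §12,
the identity behind the functional equation):
`Θ_Φ(A, B) = λ(D_M)⁻¹ |det A|_𝔸⁻ⁿ |det B|_𝔸⁻ⁿ Θ_{Φ̂}(B⁻¹, A⁻¹)`, i.e.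
`Σ_ξ Φ(A ξ B) = λ(D_M)⁻¹ |det A B|_𝔸⁻ⁿ Σ_ξ Φ̂(B⁻¹ ξ A⁻¹)`. [cite: GodementJacquet1972, §12] -/
theorem gjTheta_eq_smul_gjTheta_adelicMatrixFourier {Φ : Matrix (Fin n) (Fin n) (AdeleRing (𝓞 K) K) → ℂ}
    (hΦ : Φ ∈ schwartzBruhatAdelicMatrix n K) (A B : GL (Fin n) (AdeleRing (𝓞 K) K)) :
    gjTheta n K Φ A B =
      (lam (matrixFundamentalDomain n K)).toReal⁻¹ *
        (((adelicAbsDet n K A⁻¹ ^ n * adelicAbsDet n K B⁻¹ ^ n : ℝ≥0) : ℂ) *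
          gjTheta n K (adelicMatrixFourier n K lam Φ) B⁻¹ A⁻¹) := by
  rw [gjTheta, tsum_eq_inv_measure_mul_tsum_adelicMatrixFourier lam
    (comp_mul_mul_mem_schwartzBruhatAdelicMatrix hΦ A B)]
  have h : ∑' ξ : Matrix (Fin n) (Fin n) K, adelicMatrixFourier n K lam
      (fun x => Φ ((A : Matrix (Fin n) (Fin n) (AdeleRing (𝓞 K) K)) * x *
        (B : Matrix (Fin n) (Fin n) (AdeleRing (𝓞 K) K)))) (ratMatrix n K ξ) =
      (((adelicAbsDet n K A⁻¹ ^ n * adelicAbsDet n K B⁻¹ ^ n : ℝ≥0) : ℂ) *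
        gjTheta n K (adelicMatrixFourier n K lam Φ) B⁻¹ A⁻¹) := by
    rw [gjTheta, ← tsum_mul_left]
    exact tsum_congr fun ξ => adelicMatrixFourier_comp_mul_mul lam Φ A B (ratMatrix n K ξ)
  rw [h]

/-- **The reflection formula for the regular part**: with `L = λ(D_M)⁻¹ |det A|_𝔸⁻ⁿ |det B|_𝔸⁻ⁿ`,
`Θ_Φ^reg(A, B) = L (Θ_{Φ̂}^reg(B⁻¹, A⁻¹) + Θ_{Φ̂}^sing(B⁻¹, A⁻¹)) - Θ_Φ^sing(A, B)` — the identity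
which, integrated against two cusp forms (the singular parts then vanishing for `n ≥ 2`, resp. giving
the poles for `n = 1`), is the functional equation of the global zeta integral
(Godement–Jacquet (1972), §12–13). [cite: GodementJacquet1972, §12] -/
theorem gjThetaReg_eq_reflection {Φ : Matrix (Fin n) (Fin n) (AdeleRing (𝓞 K) K) → ℂ}
    (hΦ : Φ ∈ schwartzBruhatAdelicMatrix n K) (A B : GL (Fin n) (AdeleRing (𝓞 K) K)) :
    gjThetaReg n K Φ A B =
      (lam (matrixFundamentalDomain n K)).toReal⁻¹ *
        (((adelicAbsDet n K A⁻¹ ^ n * adelicAbsDet n K B⁻¹ ^ n : ℝ≥0) : ℂ) *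
          (gjThetaReg n K (adelicMatrixFourier n K lam Φ) B⁻¹ A⁻¹ +
            gjThetaSing n K (adelicMatrixFourier n K lam Φ) B⁻¹ A⁻¹)) -
        gjThetaSing n K Φ A B := by
  rw [← gjTheta_eq_gjThetaReg_add_gjThetaSing (adelicMatrixFourier_mem_schwartzBruhatAdelicMatrix lam hΦ),
    ← gjTheta_eq_smul_gjTheta_adelicMatrixFourier lam hΦ, gjTheta_eq_gjThetaReg_add_gjThetaSing hΦ]
  ring

end Theta

/-! ### The regular part as a sum over the arithmetic subgroup `GL_n(K) ≤ GL_n(𝔸_K)`; the case `n = 1` -/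

section Arithmetic

variable {n : ℕ} {K : Type} [Field K] [NumberField K]

/-- The adelic matrix of a rational point `γ = toAdelic g` is the rational matrix of `g`
(definitional). [folklore] -/
theorem coe_toAdelic_gl (g : GL (Fin n) K) :
    Units.val ((AdelicGroupData.gl n K).toAdelic g) = ratMatrix n K (g : Matrix (Fin n) (Fin n) K) := rfl

/-- `toAdelic : GL_n(K) → GL_n(𝔸_K)` is injective. [folklore] -/
theorem toAdelic_gl_injective : Function.Injective (AdelicGroupData.gl n K).toAdelic := by
  intro g g' h
  have h' := congrArg (fun γ : (AdelicGroupData.gl n K).Adelic => Units.val γ) h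
  simp only [coe_toAdelic_gl] at h'
  refine Units.ext (Matrix.ext fun i j => ?_)
  have := congrArg (fun M : Matrix (Fin n) (Fin n) (AdeleRing (𝓞 K) K) => M i j) h'
  exact AdeleRing.algebraMap_injective (𝓞 K) K this

variable (n K) in
/-- **`GL_n(K) ≅` the arithmetic subgroup of `GL_n(𝔸_K)`** (the range of the injective `toAdelic`).
[folklore] -/
def glRationalEquivArithmeticSubgroup : GL (Fin n) K ≃ (AdelicGroupData.gl n K).arithmeticSubgroup :=
  (Equiv.ofInjective _ toAdelic_gl_injective).trans (Equiv.setCongr rfl)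

/-- Unfolding of `glRationalEquivArithmeticSubgroup`. [folklore] -/
theorem coe_glRationalEquivArithmeticSubgroup (g : GL (Fin n) K) :
    ((glRationalEquivArithmeticSubgroup n K g : (AdelicGroupData.gl n K).arithmeticSubgroup) :
      (AdelicGroupData.gl n K).Adelic) = (AdelicGroupData.gl n K).toAdelic g := rfl

/-- **The regular part as a sum over the arithmetic subgroup**:
`Θ_Φ^reg(A, B) = Σ_{γ ∈ GL_n(K) ≤ GL_n(𝔸_K)} Φ(A γ B)` — the form in which it arises from the kernel
`K_F(x̃, ỹ) = κ ∫_{A_G} Σ_γ F(x̃ γ a ỹ⁻¹) dα` (`GLnZetaKernel`). [folklore] -/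
theorem gjThetaReg_eq_tsum_arithmeticSubgroup (Φ : Matrix (Fin n) (Fin n) (AdeleRing (𝓞 K) K) → ℂ)
    (A B : GL (Fin n) (AdeleRing (𝓞 K) K)) :
    gjThetaReg n K Φ A B = ∑' γ : (AdelicGroupData.gl n K).arithmeticSubgroup,
      Φ ((A : Matrix (Fin n) (Fin n) (AdeleRing (𝓞 K) K)) *
        Units.val (γ : (AdelicGroupData.gl n K).Adelic) *
        (B : Matrix (Fin n) (Fin n) (AdeleRing (𝓞 K) K))) := by
  rw [gjThetaReg_eq_tsum_generalLinearGroup, ← (glRationalEquivArithmeticSubgroup n K).tsum_eq]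
  rfl

omit [NumberField K] in
/-- For `n = 1` the only singular rational matrix is `0`. [folklore] -/
theorem eq_zero_of_not_isUnit_fin_one {ξ : Matrix (Fin 1) (Fin 1) K} (h : ¬ IsUnit ξ) : ξ = 0 := by
  rw [not_isUnit_iff_det_eq_zero, Matrix.det_fin_one] at h
  ext i j
  fin_cases i; fin_cases j
  exact h

/-- **For `n = 1` the singular part is the single term `Φ(0)`**: `Θ_Φ^sing(A, B) = Φ(0)`
(the term producing the poles of Tate's zeta function). [folklore] -/
theorem gjThetaSing_fin_one (Φ : Matrix (Fin 1) (Fin 1) (AdeleRing (𝓞 K) K) → ℂ)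
    (A B : GL (Fin 1) (AdeleRing (𝓞 K) K)) : gjThetaSing 1 K Φ A B = Φ 0 := by
  have h0 : ¬ IsUnit (0 : Matrix (Fin 1) (Fin 1) K) := by
    rw [not_isUnit_iff_det_eq_zero, Matrix.det_fin_one]; rfl
  rw [gjThetaSing, tsum_eq_single (⟨0, h0⟩ : {ξ : Matrix (Fin 1) (Fin 1) K // ¬ IsUnit ξ})
    (fun ξ hξ => absurd (Subtype.ext (eq_zero_of_not_isUnit_fin_one ξ.2)) hξ)]
  change Φ (_ * ratMatrix 1 K 0 * _) = Φ 0
  simp [ratMatrix, Matrix.map_zero]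

end Arithmetic

end Literature.NumberTheory.Automorphic
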